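import Mathlib.Analysis.InnerProductSpace.Basic
import Mathlib.Analysis.InnerProductSpace.PiL2
import Mathlib.LinearAlgebra.Matrix.Notation
import HarnessLib

/-!
# Quasi-orthogonality of an approximate eigenbasis against its `Q`-orthogonal complement

Analysis/OperatorTheory file (everything proved, no named facts). Let `E` be a real inner product
space, `ψ_j`, `r_j ∈ E` (`j ∈ ι` finite), `λ_j ≠ 0`, and `u ∈ E` with the *residual identity*

  `⟪ψ_j, u⟫ = − λ_j⁻¹ ⟪r_j, u⟫`   for every `j`.

(This is what an approximate generalised eigenpair `⟨ψ_j, Q v⟩ = λ_j ⟨ψ_j, v⟩_E + ⟨r_j, v⟩_E` gives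
when `u` is `Q`-orthogonal to every `ψ_j`.) Then for `g = Σ_j B_j ψ_j`:

* `⟪g, u⟫ = − ⟪Σ_j B_j λ_j⁻¹ r_j, u⟫`, hence `|⟪g, u⟫| ≤ ‖Σ_j B_j λ_j⁻¹ r_j‖ ‖u‖`
  (`abs_inner_le_norm_residualComb_mul_norm`);
* if `‖Σ_j B_j λ_j⁻¹ r_j‖ ≤ ε ‖Σ_j B_j ψ_j‖` for all coefficient vectors `B` (the *correct*
  quasi-orthogonality constant `ε₄′ := ‖G_E^{-1/2} Λ⁻¹ G_r Λ⁻¹ G_E^{-1/2}‖^{1/2}`, `G_r := (⟪r_i, r_j⟫)`),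
  then `|⟪g, u⟫| ≤ ε ‖g‖ ‖u‖` (`abs_inner_le_of_residualForm_le`);
* the entrywise bound `‖Σ_j B_j λ_j⁻¹ r_j‖ ≤ √(Σ B_j²) √(Σ (λ_j⁻¹ ‖r_j‖)²)` and, with a lower frame
  bound `Σ B_j² ≤ κ² ‖Σ B_j ψ_j‖²` (i.e. `‖G_E⁻¹‖ ≤ κ²`), the constant
  `ε₄″ := κ · |Λ⁻¹ ρ|`, `ρ_j := ‖r_j‖` (`abs_inner_le_frame_mul_norm`).

## The printed constant is not valid in general (`printed_constant_not_valid`)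

Hou–Wang–Yang, arXiv:2509.25116 v2, Lemma "Quasi-orthogonality in `Q`- and `E`-inner products"
(TeX L1753–1763, proof L3936–3938) state the bound with
`ε₄ := |G_E^{-1/2} Λ⁻¹ ρ|`, `ρ = (‖r^e_j‖_E)_j`, and the cell note `LEMMA-E.md` Lemma E.2 re-derived it
with the same constant. The proof in both places passes from `|Bᵀ Λ⁻¹ (⟨r_j, u⟩)_j|` to
`|⟨B, Λ⁻¹ρ⟩|`, which is `Σ_j |B_j| λ_j⁻¹ ρ_j ≠ |Σ_j B_j λ_j⁻¹ ρ_j|` for signed `B`; the Cauchy–Schwarz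
step `|⟨B, w⟩| ≤ (BᵀG_E B)^{1/2} (wᵀ G_E⁻¹ w)^{1/2}` then needs `wᵀ G_E⁻¹ w ≤ ρᵀΛ⁻¹G_E⁻¹Λ⁻¹ρ ‖u‖²`
from `|w_j| ≤ λ_j⁻¹ ρ_j ‖u‖`, which fails when `G_E⁻¹` has negative off-diagonal entries.
Explicit counterexample (kernel-checked below) in `E = ℝ³` (Euclidean, playing the role of `V_N` with
the `E`-inner product; `Q` symmetric positive definite):

  `Q = [[2,0,0],[0,3,1],[0,1,1]]`, `ψ₁ = (2,0,−1)`, `ψ₂ = (1,0,0)`, `λ₁ = λ₂ = 3`,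
  `r_j := Q ψ_j − λ_j ψ_j`: `r₁ = (−2,−1,2)`, `r₂ = (−1,0,0)`, `ρ = (3, 1)`,
  `G_E = [[5,2],[2,1]]`, `G_E⁻¹ = [[1,−2],[−2,5]]`, `G_Q = [[9,4],[4,2]] > 0`,
  `ε₄² = (Λ⁻¹ρ)ᵀ G_E⁻¹ (Λ⁻¹ρ) = 2/9`;
  `u = (0,−2,2)` is `Q`-orthogonal to `ψ₁, ψ₂` (`⟨Qψ_j, u⟩ = 0`), `g = −2ψ₁ + 4ψ₂ = (0,0,2) ∈ V_lg`,
  `⟪g, u⟫ = 4 > ε₄ ‖g‖ ‖u‖ = √(2/9) · 2 · √8 = 8/3`.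

When `G_E = 1_m` exactly the printed constant is valid (then `ε₄ = ε₄″`), and in general
`ε₄ ≤ ε₄″ ≤ κ(G_E)^{1/2} ε₄`; for data with `G_E` close to the identity the numerical impact is of
relative size `κ(G_E)^{1/2} − 1`. Nothing about Navier–Stokes is typed here.

## Why it is here

Elementary linear algebra ([folklore]). Corrects Lemma E.2 of `pub-nsjs/pub-nsjs-typer/LEMMA-E.md`
(Jia–Šverák programme, certified-enclosure lane; the finite-rank scheme is Hou–Wang–Yang's, which is
under adjudication in that cell and is NOT cited for this step — the bound is re-derived here and
kernel-checked, and the printed constant is refuted by the example above).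
-/

open Finset

namespace Literature.Analysis.OperatorTheory

variable {E : Type*} [NormedAddCommGroup E] [InnerProductSpace ℝ E]
variable {ι : Type*} [Fintype ι]

/-- Under the residual identity, the pairing of `g = Σ B_j ψ_j` with `u` is minus the pairing of the
weighted residual combination `Σ B_j λ_j⁻¹ r_j` with `u`. [folklore] -/
theorem inner_sum_smul_eq_neg_inner_residualComb (ψ r : ι → E) (lam : ι → ℝ) (u : E)
    (hres : ∀ j, inner ℝ (ψ j) u = -((lam j)⁻¹ * inner ℝ (r j) u)) (B : ι → ℝ) :
    inner ℝ (∑ j, B j • ψ j) u = -(inner ℝ (∑ j, (B j * (lam j)⁻¹) • r j) u) := by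
  rw [sum_inner, sum_inner, ← Finset.sum_neg_distrib]
  refine Finset.sum_congr rfl fun j _ => ?_
  rw [real_inner_smul_left, real_inner_smul_left, hres j]; ring

/-- **Quasi-orthogonality, sharp form.** `|⟪Σ B_j ψ_j, u⟫| ≤ ‖Σ B_j λ_j⁻¹ r_j‖ ‖u‖`. [folklore] -/
theorem abs_inner_le_norm_residualComb_mul_norm (ψ r : ι → E) (lam : ι → ℝ) (u : E)
    (hres : ∀ j, inner ℝ (ψ j) u = -((lam j)⁻¹ * inner ℝ (r j) u)) (B : ι → ℝ) :
    |inner ℝ (∑ j, B j • ψ j) u| ≤ ‖∑ j, (B j * (lam j)⁻¹) • r j‖ * ‖u‖ := by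
  rw [inner_sum_smul_eq_neg_inner_residualComb ψ r lam u hres B, abs_neg]
  exact abs_real_inner_le_norm _ _

/-- **Quasi-orthogonality with a form constant.** If the weighted residual combination is dominated
by `ε` times the `E`-norm of the combination, `‖Σ B_j λ_j⁻¹ r_j‖ ≤ ε ‖Σ B_j ψ_j‖` for all `B`
(`ε = ε₄′ = ‖G_E^{-1/2}Λ⁻¹G_rΛ⁻¹G_E^{-1/2}‖^{1/2}` is the least such constant), then
`|⟪g, u⟫| ≤ ε ‖g‖ ‖u‖` for every `g ∈ span ψ`. [folklore] -/
theorem abs_inner_le_of_residualForm_le (ψ r : ι → E) (lam : ι → ℝ) (u : E)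
    (hres : ∀ j, inner ℝ (ψ j) u = -((lam j)⁻¹ * inner ℝ (r j) u)) {ε : ℝ}
    (hε : ∀ B : ι → ℝ, ‖∑ j, (B j * (lam j)⁻¹) • r j‖ ≤ ε * ‖∑ j, B j • ψ j‖) (B : ι → ℝ) :
    |inner ℝ (∑ j, B j • ψ j) u| ≤ ε * ‖∑ j, B j • ψ j‖ * ‖u‖ := by
  calc |inner ℝ (∑ j, B j • ψ j) u| ≤ ‖∑ j, (B j * (lam j)⁻¹) • r j‖ * ‖u‖ :=
        abs_inner_le_norm_residualComb_mul_norm ψ r lam u hres B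
    _ ≤ ε * ‖∑ j, B j • ψ j‖ * ‖u‖ := by gcongr; exact hε B

/-- Entrywise bound on the weighted residual combination:
`‖Σ B_j λ_j⁻¹ r_j‖ ≤ √(Σ B_j²) · √(Σ (λ_j⁻¹ ‖r_j‖)²)`. [folklore] -/
theorem norm_residualComb_le_sqrt_mul_sqrt (r : ι → E) (lam : ι → ℝ) (B : ι → ℝ) :
    ‖∑ j, (B j * (lam j)⁻¹) • r j‖ ≤
      Real.sqrt (∑ j, B j ^ 2) * Real.sqrt (∑ j, ((lam j)⁻¹ * ‖r j‖) ^ 2) := by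
  calc ‖∑ j, (B j * (lam j)⁻¹) • r j‖ ≤ ∑ j, ‖(B j * (lam j)⁻¹) • r j‖ := norm_sum_le _ _
    _ = ∑ j, |B j| * (|(lam j)⁻¹| * ‖r j‖) := by
        refine Finset.sum_congr rfl fun j _ => ?_
        rw [norm_smul, Real.norm_eq_abs, abs_mul]; ring
    _ ≤ Real.sqrt (∑ j, |B j| ^ 2) * Real.sqrt (∑ j, (|(lam j)⁻¹| * ‖r j‖) ^ 2) := by
        rw [← Real.sqrt_mul (Finset.sum_nonneg fun j _ => sq_nonneg _)]
        apply Real.le_sqrt_of_sq_le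
        exact Finset.sum_mul_sq_le_sq_mul_sq _ _ _
    _ = Real.sqrt (∑ j, B j ^ 2) * Real.sqrt (∑ j, ((lam j)⁻¹ * ‖r j‖) ^ 2) := by
        congr 2
        · exact Finset.sum_congr rfl fun j _ => sq_abs _
        · refine Finset.sum_congr rfl fun j _ => ?_
          rw [mul_pow, mul_pow, sq_abs]

/-- **Quasi-orthogonality with the frame constant.** With a lower frame bound
`Σ B_j² ≤ κ² ‖Σ B_j ψ_j‖²` (`κ² ≥ ‖G_E⁻¹‖`, `κ ≥ 0`) and `ρ_j := ‖r_j‖`: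
`|⟪g, u⟫| ≤ κ · √(Σ (λ_j⁻¹ ρ_j)²) · ‖g‖ ‖u‖` — the valid replacement `ε₄″ = κ |Λ⁻¹ρ|` for the
printed `|G_E^{-1/2} Λ⁻¹ ρ|`. [folklore] -/
theorem abs_inner_le_frame_mul_norm (ψ r : ι → E) (lam : ι → ℝ) (u : E)
    (hres : ∀ j, inner ℝ (ψ j) u = -((lam j)⁻¹ * inner ℝ (r j) u)) {κ : ℝ} (hκ : 0 ≤ κ)
    (hframe : ∀ B : ι → ℝ, ∑ j, B j ^ 2 ≤ κ ^ 2 * ‖∑ j, B j • ψ j‖ ^ 2) (B : ι → ℝ) :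
    |inner ℝ (∑ j, B j • ψ j) u| ≤
      κ * Real.sqrt (∑ j, ((lam j)⁻¹ * ‖r j‖) ^ 2) * ‖∑ j, B j • ψ j‖ * ‖u‖ := by
  refine abs_inner_le_of_residualForm_le ψ r lam u hres (ε := κ * Real.sqrt (∑ j, ((lam j)⁻¹ * ‖r j‖) ^ 2)) ?_ B
  intro C
  calc ‖∑ j, (C j * (lam j)⁻¹) • r j‖
      ≤ Real.sqrt (∑ j, C j ^ 2) * Real.sqrt (∑ j, ((lam j)⁻¹ * ‖r j‖) ^ 2) :=
        norm_residualComb_le_sqrt_mul_sqrt r lam C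
    _ ≤ (κ * ‖∑ j, C j • ψ j‖) * Real.sqrt (∑ j, ((lam j)⁻¹ * ‖r j‖) ^ 2) := by
        gcongr
        calc Real.sqrt (∑ j, C j ^ 2) ≤ Real.sqrt (κ ^ 2 * ‖∑ j, C j • ψ j‖ ^ 2) :=
              Real.sqrt_le_sqrt (hframe C)
          _ = κ * ‖∑ j, C j • ψ j‖ := by
              rw [← mul_pow, Real.sqrt_sq (by positivity)]
    _ = κ * Real.sqrt (∑ j, ((lam j)⁻¹ * ‖r j‖) ^ 2) * ‖∑ j, C j • ψ j‖ := by ring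

/-! ### The printed constant fails: an explicit instance in `ℝ³` -/

namespace PrintedConstantCounterexample

/-- `Q = [[2,0,0],[0,3,1],[0,1,1]]` (symmetric positive definite). [folklore] -/
def Q : Matrix (Fin 3) (Fin 3) ℝ := !![2, 0, 0; 0, 3, 1; 0, 1, 1]
/-- `ψ₁ = (2,0,−1)`, `ψ₂ = (1,0,0)` as a family `Fin 2 → ℝ³`. [folklore] -/
def ψ : Fin 2 → EuclideanSpace ℝ (Fin 3) := ![!₂[2, 0, -1], !₂[1, 0, 0]]
/-- `λ₁ = λ₂ = 3`. [folklore] -/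
def lam : Fin 2 → ℝ := ![3, 3]
/-- residuals `r_j = Q ψ_j − λ_j ψ_j`: `r₁ = (−2,−1,2)`, `r₂ = (−1,0,0)`. [folklore] -/
def r : Fin 2 → EuclideanSpace ℝ (Fin 3) := ![!₂[-2, -1, 2], !₂[-1, 0, 0]]
/-- `u = (0,−2,2)`. [folklore] -/
def u : EuclideanSpace ℝ (Fin 3) := !₂[0, -2, 2]
/-- coefficient vector `B = (−2, 4)`, `g = Σ B_j ψ_j = (0,0,2)`. [folklore] -/
def B : Fin 2 → ℝ := ![-2, 4]
/-- `G_E = (⟪ψ_i, ψ_j⟫) = [[5,2],[2,1]]`. [folklore] -/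
def GE : Matrix (Fin 2) (Fin 2) ℝ := !![5, 2; 2, 1]
/-- `G_E⁻¹ = [[1,−2],[−2,5]]`. [folklore] -/
def GEinv : Matrix (Fin 2) (Fin 2) ℝ := !![1, -2; -2, 5]
/-- `Λ⁻¹ρ = (‖r_j‖/λ_j)_j = (1, 1/3)`. [folklore] -/
noncomputable def c : Fin 2 → ℝ := ![1, 1/3]

/-- `Q` is symmetric. [folklore] -/
theorem Q_symm : Q.transpose = Q := by
  ext i j; fin_cases i <;> fin_cases j <;> rfl

/-- `r_j = Q ψ_j − λ_j ψ_j` coordinatewise. [folklore] -/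
theorem r_eq (j : Fin 2) (i : Fin 3) : r j i = (Q.mulVec (fun k => ψ j k)) i - lam j * ψ j i := by
  fin_cases j <;> fin_cases i <;>
    (simp [r, Q, ψ, lam, Matrix.mulVec, dotProduct, Fin.sum_univ_three]; try norm_num)

/-- `u` is `Q`-orthogonal to `ψ₁, ψ₂`. [folklore] -/
theorem u_Qorth (j : Fin 2) : ∑ i, (Q.mulVec (fun k => ψ j k)) i * u i = 0 := by
  fin_cases j <;>
    simp [Q, ψ, u, Matrix.mulVec, dotProduct, Fin.sum_univ_three]

/-- Gram matrix entries `G_E = (⟪ψ_i, ψ_j⟫)`. [folklore] -/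
theorem GE_eq (i j : Fin 2) : GE i j = inner ℝ (ψ i) (ψ j) := by
  have hsq : ∀ x : EuclideanSpace ℝ (Fin 3), ‖x‖ ^ 2 = ∑ i, x i ^ 2 := by
    intro x
    rw [EuclideanSpace.norm_eq, Real.sq_sqrt (Finset.sum_nonneg fun _ _ => sq_nonneg _)]
    simp
  fin_cases i <;> fin_cases j <;>
    (simp [GE, ψ, EuclideanSpace.inner_eq_star_dotProduct, dotProduct, Fin.sum_univ_three, hsq];
     try norm_num)

/-- `G_E · G_E⁻¹ = 1`. [folklore] -/
theorem GE_mul_GEinv : GE * GEinv = 1 := by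
  ext i j; fin_cases i <;> fin_cases j <;> simp [GE, GEinv, Matrix.mul_apply, Fin.sum_univ_two] <;> norm_num

/-- `c_j = ‖r_j‖ / λ_j`. [folklore] -/
theorem c_eq (j : Fin 2) : c j = (lam j)⁻¹ * ‖r j‖ := by
  fin_cases j
  · have h9 : Real.sqrt 9 = 3 := by
      rw [show (9 : ℝ) = 3 ^ 2 by norm_num, Real.sqrt_sq (by norm_num)]
    simp [c, lam, r, EuclideanSpace.norm_eq, Fin.sum_univ_three]
    norm_num [h9]
    try norm_num
  · simp [c, lam, r, EuclideanSpace.norm_eq, Fin.sum_univ_three]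

/-- the printed `ε₄² = (Λ⁻¹ρ)ᵀ G_E⁻¹ (Λ⁻¹ρ) = 2/9`. [folklore] -/
theorem eps4_sq : ∑ i, ∑ j, c i * GEinv i j * c j = 2 / 9 := by
  simp [c, GEinv, Fin.sum_univ_two]; norm_num

/-- The residual identity `⟪ψ_j, u⟫ = −λ_j⁻¹ ⟪r_j, u⟫` holds for the data. [folklore] -/
theorem hres (j : Fin 2) : inner ℝ (ψ j) u = -((lam j)⁻¹ * inner ℝ (r j) u) := by
  fin_cases j <;>
    (simp [ψ, r, u, lam, EuclideanSpace.inner_eq_star_dotProduct, dotProduct, Fin.sum_univ_three];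
     try norm_num)

/-- `g = Σ B_j ψ_j = (0,0,2)`. [folklore] -/
theorem g_eq : (∑ j, B j • ψ j) = !₂[0, 0, 2] := by
  ext i; fin_cases i <;> (simp [B, ψ, Fin.sum_univ_two]; try norm_num)

/-- `⟪g, u⟫ = 4`. [folklore] -/
theorem inner_g_u : inner ℝ (∑ j, B j • ψ j) u = 4 := by
  rw [g_eq]; simp [u, EuclideanSpace.inner_eq_star_dotProduct, dotProduct, Fin.sum_univ_three]; norm_num

/-- `‖g‖ = 2`. [folklore] -/
theorem norm_g : ‖∑ j, B j • ψ j‖ = 2 := by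
  rw [g_eq, EuclideanSpace.norm_eq]
  simp [Fin.sum_univ_three]

/-- `‖u‖ = √8`. [folklore] -/
theorem norm_u : ‖u‖ = Real.sqrt 8 := by
  rw [EuclideanSpace.norm_eq]; simp [u, Fin.sum_univ_three]; norm_num

/-- **The printed bound fails**: `|⟪g, u⟫| = 4 > √(2/9) · ‖g‖ · ‖u‖ = 8/3`, although the residual
identity (`hres`), `Q`-orthogonality (`u_Qorth`), `r_j = Qψ_j − λ_jψ_j` (`r_eq`), `G_E G_E⁻¹ = 1`
(`GE_mul_GEinv`) and `ε₄² = cᵀ G_E⁻¹ c = 2/9` (`eps4_sq`) all hold. [folklore] -/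
theorem printed_constant_not_valid :
    ¬ (|inner ℝ (∑ j, B j • ψ j) u| ≤ Real.sqrt (2 / 9) * ‖∑ j, B j • ψ j‖ * ‖u‖) := by
  rw [inner_g_u, norm_g, norm_u]
  intro h
  have h8 : Real.sqrt (2 / 9) * Real.sqrt 8 = 4 / 3 := by
    rw [← Real.sqrt_mul (by norm_num)]
    rw [show (2 / 9 : ℝ) * 8 = (4 / 3) ^ 2 by norm_num, Real.sqrt_sq (by norm_num)]
  have : Real.sqrt (2 / 9) * 2 * Real.sqrt 8 = 8 / 3 := by
    calc Real.sqrt (2 / 9) * 2 * Real.sqrt 8 = 2 * (Real.sqrt (2 / 9) * Real.sqrt 8) := by ring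
      _ = 8 / 3 := by rw [h8]; norm_num
  rw [this] at h
  norm_num at h

end PrintedConstantCounterexample

end Literature.Analysis.OperatorTheory
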